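import Summits.AtomisticToContinuum.Crystallization.Theorems.ChargedEnergyGap.Negative.NoBoundaryReduction
import Literature.MathematicalPhysics.StatisticalMechanics.PeriodicConfigurationSums
import Literature.Barriers.AtomisticToContinuum.SutoDegenerateGroundStates
import Literature.MathematicalPhysics.StatisticalMechanics.StablePotentialsProofs

/-!
# `ChargedEnergyGap` (stmt-AtomisticToContinuum-14231), negative side III: the `κ = 0` half is elementary; shape tightness

Given item 0714, `N·e* ≤ E_LJ(y)` for every injective `y` (periodisation with the cubic lattice),
so the crux is pure pricing (`chargedEnergyGap_iff_pricing`); a witness is a near-minimiser;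
linear allowance `C·N` is trivially true; without injectivity the statement is false.  All `[folklore]`.
-/

noncomputable section

namespace Summit.AtomisticToContinuum.Crystallization.Theorems.ChargedEnergyGapNegative

open Literature.MathematicalPhysics.StatisticalMechanics
open Literature.Geometry.DiscreteGeometry
open Summit.AtomisticToContinuum.Crystallization.Theses.PricedLinkCensus
open scoped BigOperators

/-! ## §4. The `κ = 0` half holds with `C = 0`: `N·e* ≤ E_LJ(y)` by periodisation

Periodise an injective `y` with the cubic lattice `Lℤ³`, `L = 2Σᵢ‖yᵢ‖ + 2`: the periodic images
are at mutual distances `≥ 2`, where `V_LJ ≤ 0`, so `e(periodisation) ≤ E_LJ(y)/N`, whence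
`e* ≤ E_LJ(y)/N` as soon as `e*` is the genuine infimum (`BddBelow`, item 0714).  Consequently
the ENERGETIC half of the crux ("contains `liminf E(N)/N ≥ e*`", labelled open in the item's
informal text) is elementary in this formulation: the periodic infimum is an infimum over ALL
periodic configurations, dilute periodic arrays of clusters included.  The whole content of the
crux is carried by `0 < κ`.  (Construction ported from the sibling work file
`Cruxes/StarCoercivity/Disproof.lean` §5, generation 2, with the tree's `cubicLattice`.) -/

section Periodise

open Literature.Barriers.AtomisticToContinuum (cubicLattice cubicBasis cubicBasis_apply)

variable {N : ℕ} (x : Fin N → E3)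

/-- The period `L = 2·Σ‖x i‖ + 2`. [folklore] -/
def period : ℝ := 2 * Dsum x + 2

/-- `0 < L`. [folklore] -/
theorem period_pos : 0 < period x := by unfold period; linarith [Dsum_nonneg x]

/-- The period as a unit of `ℝ`. [folklore] -/
def periodUnit : ℝˣ := Units.mk0 (period x) (period_pos x).ne'

/-- The unit's value is the period. [folklore] -/
@[simp] theorem val_periodUnit : (periodUnit x : ℝ) = period x := rfl

/-- Coordinates of vectors of the cubic lattice `cℤ³` are integer multiples of `c`. [folklore] -/
theorem exists_int_coord_of_mem_cubicLattice (c : ℝˣ) {v : E3} (hv : v ∈ cubicLattice c)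
    (j : Fin 3) : ∃ n : ℤ, v j = (c : ℝ) * n := by
  induction hv using Submodule.span_induction generalizing j with
  | mem v hv =>
    obtain ⟨i, rfl⟩ := hv
    rw [cubicBasis_apply]
    by_cases hji : j = i
    · subst hji; exact ⟨1, by simp⟩
    · exact ⟨0, by simp [hji]⟩
  | zero => exact ⟨0, by simp⟩
  | add u w _ _ hu hw =>
    obtain ⟨n, hn⟩ := hu j
    obtain ⟨m, hm⟩ := hw j
    exact ⟨n + m, by simp [hn, hm, mul_add]⟩
  | smul a u _ hu =>
    obtain ⟨n, hn⟩ := hu j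
    exact ⟨a * n, by simp [hn]; ring⟩

/-- Non-zero vectors of `cℤ³` (`c > 0`) have norm `≥ c`. [folklore] -/
theorem le_norm_of_mem_cubicLattice {c : ℝˣ} (hc : 0 < (c : ℝ)) {v : E3}
    (hv : v ∈ cubicLattice c) (hv0 : v ≠ 0) : (c : ℝ) ≤ ‖v‖ := by
  have hex : ∃ j, v j ≠ 0 := by
    by_contra hall
    push Not at hall
    exact hv0 (PiLp.ext fun j => by simpa using hall j)
  obtain ⟨j, hj⟩ := hex
  obtain ⟨n, hn⟩ := exists_int_coord_of_mem_cubicLattice c hv j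
  have hn0 : n ≠ 0 := by
    rintro rfl
    simp at hn
    exact hj hn
  have hn1 : (1 : ℝ) ≤ |(n : ℝ)| := by
    rw [← Int.cast_abs]; exact_mod_cast Int.one_le_abs hn0
  have hcoord : |v j| ≤ ‖v‖ := by
    have := PiLp.norm_apply_le v j
    simpa using this
  calc (c : ℝ) ≤ (c : ℝ) * |(n : ℝ)| := le_mul_of_one_le_right hc.le hn1
    _ = |v j| := by rw [hn, abs_mul, abs_of_pos hc]
    _ ≤ ‖v‖ := hcoord

/-- **Periodisation** of a configuration of `N ≥ 1` points of `ℝ³` with the cubic lattice `cℤ³`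
of any period `c ≥ L = 2Σ‖xᵢ‖ + 2` (motif `= {xᵢ}`; distinct motif points differ by less than
`c`, the length of the shortest non-zero period). [folklore] -/
def periodise (c : ℝˣ) (hc : period x ≤ (c : ℝ)) (hN : 0 < N) : PeriodicConfiguration 3 where
  lattice := cubicLattice c
  discrete := inferInstance
  isZLattice := inferInstance
  motif := Finset.univ.image x
  motif_nonempty := by
    haveI : Nonempty (Fin N) := ⟨⟨0, hN⟩⟩
    exact Finset.univ_nonempty.image x
  eq_of_sub_mem := by
    intro p hp q hq hpq
    obtain ⟨i, -, rfl⟩ := Finset.mem_image.1 hp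
    obtain ⟨j, -, rfl⟩ := Finset.mem_image.1 hq
    by_contra hne
    have hcpos : 0 < (c : ℝ) := lt_of_lt_of_le (period_pos x) hc
    have h1 := le_norm_of_mem_cubicLattice hcpos hpq (sub_ne_zero.2 hne)
    have h2 : ‖x i - x j‖ ≤ 2 * Dsum x := by rw [← dist_eq_norm]; exact dist_le_two_Dsum x i j
    unfold period at hc
    linarith

/-- The motif of the periodisation is `{xᵢ}`. [folklore] -/
theorem motif_periodise (c : ℝˣ) (hc : period x ≤ (c : ℝ)) (hN : 0 < N) :
    (periodise x c hc hN).motif = Finset.univ.image x := rfl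

/-- Points of the periodisation other than the `xⱼ` themselves are at distance `≥ c − 2D ≥ 2`
from every `xᵢ` (a non-zero period has length `≥ c`). [folklore] -/
theorem sub_le_dist_of_mem_points (c : ℝˣ) (hc : period x ≤ (c : ℝ)) (hN : 0 < N) (i : Fin N)
    {y : E3} (hy : y ∈ (periodise x c hc hN).points) (hyx : ∀ j, y ≠ x j) :
    (c : ℝ) - 2 * Dsum x ≤ dist (x i) y := by
  obtain ⟨z, hz, g, hg, rfl⟩ := hy
  rw [motif_periodise] at hz
  obtain ⟨j, -, rfl⟩ := Finset.mem_image.1 hz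
  have hg0 : g ≠ 0 := by
    rintro rfl
    exact hyx j (by simp)
  have hcpos : 0 < (c : ℝ) := lt_of_lt_of_le (period_pos x) hc
  have hL : (c : ℝ) ≤ ‖g‖ := le_norm_of_mem_cubicLattice hcpos hg hg0
  rw [dist_eq_norm]
  have h1 : ‖g‖ - ‖x i - x j‖ ≤ ‖x i - (x j + g)‖ := by
    rw [show x i - (x j + g) = (x i - x j) - g by abel, ← norm_neg ((x i - x j) - g), neg_sub]
    exact norm_sub_norm_le g (x i - x j)
  have h2 : ‖x i - x j‖ ≤ 2 * Dsum x := by rw [← dist_eq_norm]; exact dist_le_two_Dsum x i j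
  linarith

/-- In particular they are at distance `≥ 2`. [folklore] -/
theorem two_le_dist_of_mem_points (c : ℝˣ) (hc : period x ≤ (c : ℝ)) (hN : 0 < N) (i : Fin N)
    {y : E3} (hy : y ∈ (periodise x c hc hN).points) (hyx : ∀ j, y ≠ x j) : 2 ≤ dist (x i) y := by
  have := sub_le_dist_of_mem_points x c hc hN i hy hyx
  unfold period at hc
  linarith

variable {x}

/-- The lattice sum at `xᵢ` over the periodisation is at most the finite site energy
`∑_{k ≠ i} V_LJ(|xᵢ − x_k|)`: the remaining terms are `≤ 0`. [folklore] -/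
theorem tsum_le_siteEnergy (hx : Function.Injective x) (c : ℝˣ) (hc : period x ≤ (c : ℝ))
    (hN : 0 < N) (i : Fin N) :
    (∑' y : {y : E3 // y ∈ (periodise x c hc hN).points ∧ y ≠ x i},
        lennardJones (dist (x i) y.1)) ≤ siteEnergy lennardJones x i := by
  set P := periodise x c hc hN with hP
  set f : {y : E3 // y ∈ P.points ∧ y ≠ x i} → ℝ := fun y => lennardJones (dist (x i) y.1)
    with hf
  have hsum : Summable f := P.summable_lennardJones_dist_three (x i)
  have hmem : ∀ k : {k // k ∈ Finset.univ.erase i}, x k.1 ∈ P.points ∧ x k.1 ≠ x i := fun k =>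
    ⟨P.mem_points_of_mem_motif (by
        rw [hP, motif_periodise]; exact Finset.mem_image_of_mem x (Finset.mem_univ _)),
      hx.ne (Finset.ne_of_mem_erase k.2)⟩
  set emb : {k // k ∈ Finset.univ.erase i} → {y : E3 // y ∈ P.points ∧ y ≠ x i} :=
    fun k => ⟨x k.1, hmem k⟩ with hemb
  have hinj : Function.Injective emb := by
    intro k l hkl
    have h1 : x k.1 = x l.1 := congrArg Subtype.val hkl
    exact Subtype.ext (hx h1)
  set s₀ : Finset {y : E3 // y ∈ P.points ∧ y ≠ x i} := (Finset.univ.erase i).attach.image emb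
    with hs₀
  have hsign : ∀ y ∉ s₀, 0 ≤ (fun b => -f b) y := by
    intro y hy
    have hfar : ∀ j, y.1 ≠ x j := by
      intro j hj
      by_cases hji : j = i
      · exact y.2.2 (hji ▸ hj)
      · exact hy (Finset.mem_image.2 ⟨⟨j, Finset.mem_erase.2 ⟨hji, Finset.mem_univ j⟩⟩,
          Finset.mem_attach _ _, Subtype.ext hj.symm⟩)
    have h1 := two_le_dist_of_mem_points x c hc hN i y.2.1 hfar
    simp only [hf, neg_nonneg]
    exact lennardJones_nonpos (by linarith)
  have h1 := sum_le_hasSum s₀ hsign hsum.hasSum.neg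
  have h2 : ∑ y ∈ s₀, f y = siteEnergy lennardJones x i := by
    rw [hs₀, Finset.sum_image fun k _ l _ h => hinj h]
    exact Finset.sum_attach (Finset.univ.erase i) fun k => lennardJones (dist (x i) (x k))
  rw [Finset.sum_neg_distrib, h2] at h1
  linarith

/-- Hence `e(periodisation of x) ≤ E_LJ(x)/N`. [folklore] -/
theorem energyPerParticle_periodise_le (hx : Function.Injective x) (c : ℝˣ)
    (hc : period x ≤ (c : ℝ)) (hN : 0 < N) :
    (periodise x c hc hN).energyPerParticle lennardJones ≤
      interactionEnergy lennardJones x / N := by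
  have hcard : (periodise x c hc hN).motif.card = N := by
    rw [motif_periodise, Finset.card_image_of_injective _ hx, Finset.card_univ, Fintype.card_fin]
  have hNr : (0 : ℝ) < N := by exact_mod_cast hN
  unfold PeriodicConfiguration.energyPerParticle
  rw [hcard]
  have hsum : ∑ z ∈ (periodise x c hc hN).motif,
      ∑' y : {y : E3 // y ∈ (periodise x c hc hN).points ∧ y ≠ z}, lennardJones (dist z y.1) ≤
        ∑ i, siteEnergy lennardJones x i := by
    rw [motif_periodise, Finset.sum_image fun i _ j _ h => hx h]
    exact Finset.sum_le_sum fun i _ => tsum_le_siteEnergy hx c hc hN i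
  rw [← two_mul_interactionEnergy] at hsum
  calc (2 * (N : ℝ))⁻¹ * ∑ z ∈ (periodise x c hc hN).motif,
        ∑' y : {y : E3 // y ∈ (periodise x c hc hN).points ∧ y ≠ z}, lennardJones (dist z y.1)
      ≤ (2 * (N : ℝ))⁻¹ * (2 * interactionEnergy lennardJones x) :=
        mul_le_mul_of_nonneg_left hsum (by positivity)
    _ = interactionEnergy lennardJones x / N := by
        field_simp

end Periodise

/-- **`N·e* ≤ E_LJ(y)` for every injective configuration** (given that `e*` is the genuine
infimum, item 0714): the `κ = 0`, `C = 0` instance of the crux. [folklore] -/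
theorem card_mul_eStar_le_interactionEnergy
    (hB : BddBelow (Set.range fun Q : PeriodicConfiguration 3 => Q.energyPerParticle lennardJones))
    {N : ℕ} {x : Fin N → E3} (hx : Function.Injective x) :
    (N : ℝ) * eStar ≤ interactionEnergy lennardJones x := by
  rcases Nat.eq_zero_or_pos N with rfl | hN
  · simp [interactionEnergy]
  · have h1 : eStar ≤ (periodise x (periodUnit x) le_rfl hN).energyPerParticle lennardJones :=
      ciInf_le hB _
    have h2 := energyPerParticle_periodise_le hx (periodUnit x) le_rfl hN
    have hNr : (0 : ℝ) < N := by exact_mod_cast hN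
    have := h1.trans h2
    rwa [le_div_iff₀ hNr, mul_comm] at this

/-- **The `κ = 0` gap is TRUE (with `C = 0`) iff item 0714 holds.**  (`→`: by periodisation;
`←`: in the junk world `e* = 0` and the dimer has energy `−1/12 < 0 = N·e*`.) [folklore] -/
theorem gapWith_zero_zero_iff (η : ℝ) :
    GapWith η 0 0 ↔
      BddBelow (Set.range fun Q : PeriodicConfiguration 3 => Q.energyPerParticle lennardJones) := by
  constructor
  · intro h
    by_contra hb
    have h0 : eStar = 0 := Real.iInf_of_not_bddBelow hb
    have := h 2 dimer dimer_injective
    rw [interactionEnergy_dimer, h0] at this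
    norm_num at this
  · intro hB N y hy
    have := card_mul_eStar_le_interactionEnergy hB hy
    simpa using this

/-- Hence, granted 0714, the crux is EQUIVALENT to its pure pricing content: a uniform price
`κ > 0` per charged site on the (non-negative) excess `E_LJ(y) − N·e*`. [folklore] -/
theorem chargedEnergyGap_iff_pricing :
    ChargedEnergyGap ↔
      BddBelow (Set.range fun Q : PeriodicConfiguration 3 => Q.energyPerParticle lennardJones) ∧
      ∃ κ : ℝ, 0 < κ ∧ ∀ (N : ℕ) (y : Fin N → E3), Function.Injective y →
        κ * (charged (1 / 100) y : ℝ) ≤ interactionEnergy lennardJones y - (N : ℝ) * eStar := by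
  rw [chargedEnergyGap_iff_noBoundary]
  constructor
  · rintro ⟨κ, hκ, h⟩
    refine ⟨?_, κ, hκ, fun N y hy => by linarith [h N y hy]⟩
    exact bddBelow_of_chargedEnergyGap
      (chargedEnergyGap_iff_noBoundary.2 ⟨κ, hκ, h⟩)
  · rintro ⟨-, κ, hκ, h⟩
    exact ⟨κ, hκ, fun N y hy => by linarith [h N y hy]⟩

/-- **A refutation witness is a near-minimiser with dense charge.**  If `y` violates the price `κ`
(the shape required by `not_gapWith_of_witness`), then — granted 0714 — its excess energy is
squeezed: `0 ≤ E(y) − N·e* < κ·#charged(y) ≤ κ·N`.  Certifying such a witness in Lean needs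
`e*` from BELOW to precision `κ` per particle, i.e. a sharp lower bound on the periodic
minimum along an explicit family. [folklore] -/
theorem nearMinimiser_of_violation
    (hB : BddBelow (Set.range fun Q : PeriodicConfiguration 3 => Q.energyPerParticle lennardJones))
    {η κ : ℝ} {N : ℕ} {y : Fin N → E3} (hy : Function.Injective y)
    (hlt : interactionEnergy lennardJones y < (N : ℝ) * eStar + κ * (charged η y : ℝ)) :
    0 ≤ interactionEnergy lennardJones y - (N : ℝ) * eStar ∧
      interactionEnergy lennardJones y - (N : ℝ) * eStar < κ * (charged η y : ℝ) ∧
      (charged η y : ℝ) ≤ N := by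
  refine ⟨by linarith [card_mul_eStar_le_interactionEnergy hB hy], by linarith, ?_⟩
  unfold charged
  exact_mod_cast (Finite.card_subtype_le _).trans_eq (Nat.card_fin N)


/-! ## §5. Tightness of the shape: linear allowance is trivial; injectivity is load-bearing -/

section Shape

/-- A constant configuration has zero Lennard-Jones energy (`V_LJ(0) = 0`, Lean's `0⁻¹ = 0`). [folklore] -/
theorem interactionEnergy_const (N : ℕ) (c : E3) :
    interactionEnergy lennardJones (fun _ : Fin N => c) = 0 := by
  unfold interactionEnergy
  simp [lennardJones_zero]

/-- **With a LINEAR allowance `C·N` the priced gap is trivially true** (unconditionally, even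
with price `κ = 1`): `#charged ≤ N`, `E_LJ ≥ −(2³²/12)·N` (finite stability, tree), and
`e* ≤ max 0 e(Q₀)` for any fixed periodic `Q₀` (genuine infimum or junk `0`).  So the content
of the crux sits exactly in the SUBLINEAR allowance `N^(2/3)` — equivalently (§3) in no
allowance at all. [folklore] -/
theorem gapWith_linear_allowance :
    ∃ κ C : ℝ, 0 < κ ∧ ∀ (N : ℕ) (y : Fin N → E3), Function.Injective y →
      (N : ℝ) * eStar + κ * (charged (1 / 100) y : ℝ) - C * (N : ℝ) ≤
        interactionEnergy lennardJones y := by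
  set Q₀ : PeriodicConfiguration 3 := periodise dimer (periodUnit dimer) le_rfl (by norm_num : 0 < 2)
    with hQ₀
  refine ⟨1, 1 + max 0 (Q₀.energyPerParticle lennardJones) + 65536 ^ 2 / 12, one_pos, ?_⟩
  intro N y hy
  have hE : -((65536 ^ 2 / 12 : ℝ) * N) ≤ interactionEnergy lennardJones y :=
    le_interactionEnergy_lennardJones (by norm_num) N y hy
  have hch : (charged (1 / 100) y : ℝ) ≤ N := by
    unfold charged
    exact_mod_cast (Finite.card_subtype_le _).trans_eq (Nat.card_fin N)
  have he : eStar ≤ max 0 (Q₀.energyPerParticle lennardJones) := by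
    by_cases hB : BddBelow (Set.range fun Q : PeriodicConfiguration 3 =>
        Q.energyPerParticle lennardJones)
    · exact (ciInf_le hB Q₀).trans (le_max_right _ _)
    · rw [show eStar = 0 from Real.iInf_of_not_bddBelow hB]
      exact le_max_left _ _
  have hN0 : (0 : ℝ) ≤ N := Nat.cast_nonneg N
  have h1 : (N : ℝ) * eStar ≤ (N : ℝ) * max 0 (Q₀.energyPerParticle lennardJones) :=
    mul_le_mul_of_nonneg_left he hN0
  nlinarith

/-- The crux with the hypothesis `Function.Injective y` DROPPED. [folklore] -/
def GapNonInj (η κ C : ℝ) : Prop :=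
  ∀ (N : ℕ) (y : Fin N → E3),
    (N : ℝ) * eStar + κ * (charged η y : ℝ) - C * (N : ℝ) ^ (2 / 3 : ℝ) ≤
      interactionEnergy lennardJones y

/-- The pile-up `k` particles at `0` and `k` particles at `e₀` (not injective for `k ≥ 2`). [folklore] -/
def pile (k : ℕ) : Fin (k + k) → E3 :=
  Fin.append (fun _ : Fin k => (0 : E3)) (fun _ : Fin k => e0)

/-- `E(pile k) = −k²/12`: the `k²` cross pairs sit at the potential minimum, coincident pairs
contribute `V_LJ(0) = 0`. [folklore] -/
theorem interactionEnergy_pile (k : ℕ) :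
    interactionEnergy lennardJones (pile k) = -((k : ℝ) ^ 2 / 12) := by
  unfold pile
  rw [interactionEnergy_append lennardJones lennardJones_zero, interactionEnergy_const,
    interactionEnergy_const]
  simp only [dist_zero_left, norm_e0, lennardJones_one, Finset.sum_const, Finset.card_univ,
    Fintype.card_fin, nsmul_eq_mul]
  ring

/-- **Injectivity is load-bearing**: without it the inequality fails for EVERY `η`, `κ`, `C`
(the pile-up has energy `−k²/12`, quadratic in `N = 2k`, against a left side `≥ −O(N)`).
Any proof of the crux must use `Function.Injective y` (it is the only hypothesis on `y`). [folklore] -/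
theorem not_gapNonInj (η κ C : ℝ) : ¬ GapNonInj η κ C := by
  intro h
  -- a large `k`
  obtain ⟨k₀, hk₀⟩ := exists_nat_gt (24 * (|κ| + |C| + |eStar|))
  set k := k₀ + 1 with hk
  have hk1 : (1 : ℝ) ≤ k := by simp [hk]
  have hkpos : (0 : ℝ) < k := by linarith
  have hk₀' : 24 * (|κ| + |C| + |eStar|) < k := by
    have : (k₀ : ℝ) ≤ k := by simp [hk]
    linarith
  have hg := h (k + k) (pile k)
  rw [interactionEnergy_pile] at hg
  push_cast at hg
  -- bounds on the three left-hand terms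
  have hch : (charged η (pile k) : ℝ) ≤ k + k := by
    unfold charged
    exact_mod_cast (Finite.card_subtype_le _).trans_eq (Nat.card_fin (k + k))
  have hch0 : (0 : ℝ) ≤ (charged η (pile k) : ℝ) := Nat.cast_nonneg _
  have hA0 : (0 : ℝ) ≤ ((k : ℝ) + k) ^ (2 / 3 : ℝ) := Real.rpow_nonneg (by linarith) _
  have hA : ((k : ℝ) + k) ^ (2 / 3 : ℝ) ≤ (k : ℝ) + k := by
    have h1 : (1 : ℝ) ≤ (k : ℝ) + k := by linarith
    calc ((k : ℝ) + k) ^ (2 / 3 : ℝ) ≤ ((k : ℝ) + k) ^ (1 : ℝ) :=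
          Real.rpow_le_rpow_of_exponent_le h1 (by norm_num)
      _ = (k : ℝ) + k := Real.rpow_one _
  have h1 : -(|κ| * (k + k)) ≤ κ * (charged η (pile k) : ℝ) := by
    have := neg_abs_le (κ * (charged η (pile k) : ℝ))
    rw [abs_mul, abs_of_nonneg hch0] at this
    nlinarith [abs_nonneg κ]
  have h2 : -(|C| * (k + k)) ≤ -(C * ((k : ℝ) + k) ^ (2 / 3 : ℝ)) := by
    have := le_abs_self (C * ((k : ℝ) + k) ^ (2 / 3 : ℝ))
    rw [abs_mul, abs_of_nonneg hA0] at this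
    nlinarith [abs_nonneg C]
  have h3 : -(|eStar| * (k + k)) ≤ ((k : ℝ) + k) * eStar := by
    have := neg_abs_le (((k : ℝ) + k) * eStar)
    rw [abs_mul, abs_of_nonneg (by linarith : (0 : ℝ) ≤ k + k)] at this
    linarith
  -- so `k²/12 ≤ 2k(|κ| + |C| + |e*|)`, i.e. `k ≤ 24(|κ| + |C| + |e*|)`: contradiction
  have h4 : (k : ℝ) ^ 2 / 12 ≤ (k + k) * (|κ| + |C| + |eStar|) := by nlinarith
  have h5 : (k : ℝ) ≤ 24 * (|κ| + |C| + |eStar|) := by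
    rw [pow_two] at h4
    have : (k : ℝ) * (k - 24 * (|κ| + |C| + |eStar|)) ≤ 0 := by nlinarith
    nlinarith
  linarith

end Shape

end Summit.AtomisticToContinuum.Crystallization.Theorems.ChargedEnergyGapNegative

end
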